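import Mathlib
import HarnessLib
import HarnessLib.Audit
import Summits.CriticalPhenomena.PercolationContinuityZ3.Theorems.PercNearOneGluingNoHeavyLowerTailHexMSMatchTightCase

/-!
# Conjecture (MATCH), two dead classes: the Δ-MS-tight case from the structure of equality in Marica–Schönheim (hp-7 gen 69)

Support file for crux `stmt-CriticalPhenomena-4575` (route `PercNearOneGluingNoHeavy`), hull-port seat `prim-hp-7` (generation 69);
`--supports stmt-CriticalPhenomena-4575`.  No `sorry`.  Memo: `run/shared/lean/prim/prim-hp-7/FROM-prim-hp-7-g69-MATCH-SYMMETRIC.md` §4.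

* `MSEqualityStructure α` — the STRUCTURE OF EQUALITY in the Marica–Schönheim inequality, as an explicit `Prop` (an obligation here, never asserted):
  every family `G` of finite sets with `#(G \\ G) = #G` is a TWISTED PRODUCT `{a ∪ (I \ d₁) ∪ d₂ : d₁ ∈ D₁, d₂ ∈ D₂}` of two difference-closed families
  (`D₁ ⊆ 𝒫 I`, `D₂` disjoint from `a ∪ I`).  Gen 69 verified it EXHAUSTIVELY over all 65 535 families on `2^[4]` (717 tight families, all twisted products; no
  non-tight family is one) and on random families of `2^[5]`; it is presumably the equality theorem of Aharoni–Holzman (J. London Math. Soc. 48 (1993) 385;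
  not held at the time of writing, acq-08428), equivalently: `∃ c ∈ G, {c △ d : d ∈ G \\ G} = G`.
* `card_diffs_eq_card_of_cl_tight` — for an INTERSECTING family inside `U`, `F \\ F` and its complement image are disjoint, so Δ-MS-tightness
  `#(F \\ F ∪ co(F \\ F)) = 2 #F` is the same as MS-tightness `#(F \\ F) = #F`.
* `card_le_card_biUnion_candidates_of_tight` — **assuming `MSEqualityStructure α`, Hall's condition `#A ≤ #N(A)` holds for `A = cl F` whenever `F` is a
  Δ-MS-TIGHT two-class family of dead members** (labels in `{ℓ, ℓ+1}`): by `…HexMSMatchTightCase` a twisted-product two-class dead family has no blocked pair and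
  its candidates contain `cl(F \\ F)`.  This is the tight case of gen 69's two-class conjecture V-b (exact for n ≤ 6 by SAT; the statement 'tight ⟹ no blocker'
  itself is exact for n ≤ 6, kit j235242).
-/

namespace Summit.CriticalPhenomena.PercolationContinuityZ3.Theorems

namespace GeneratedDonors

open Finset FinsetFamily

/-- **Structure of equality in Marica–Schönheim** (as an obligation): every MS-tight family is a twisted product of two difference-closed families.
Exhaustively verified on `2^[4]`; presumably [Aharoni–Holzman 1993].  Never asserted in this file. -/
def MSEqualityStructure (α : Type*) [DecidableEq α] : Prop :=
  ∀ G : Finset (Finset α), #(G \\ G) = #G →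
    ∃ a I : Finset α, ∃ D₁ D₂ : Finset (Finset α),
      (∀ d ∈ D₁, d ⊆ I) ∧ (∀ d ∈ D₂, Disjoint d (a ∪ I)) ∧
      (∀ d ∈ D₁, ∀ d' ∈ D₁, d \ d' ∈ D₁) ∧ (∀ d ∈ D₂, ∀ d' ∈ D₂, d \ d' ∈ D₂) ∧
      G = (D₁ ×ˢ D₂).image (fun e => a ∪ (I \ e.1) ∪ e.2)

variable {α : Type*} [DecidableEq α]
variable {U : Finset α} {𝒟 : Finset (Finset α)} {x : Finset α → ZMod 6}

/-- For an intersecting family of subsets of `U`, no difference of two members is the complement of another such difference; hence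
`#(F \\ F ∪ co (F \\ F)) = 2 · #(F \\ F)`, and Δ-MS-tightness `= 2 #F` forces `#(F \\ F) = #F`. -/
theorem card_diffs_eq_card_of_cl_tight {F : Finset (Finset α)} (hFU : ∀ f ∈ F, f ⊆ U)
    (hint : ∀ f ∈ F, ∀ g ∈ F, (f ∩ g).Nonempty)
    (htight : #((F \\ F) ∪ (F \\ F).image (fun z => U \ z)) = 2 * #F) : #(F \\ F) = #F := by
  have hdisj : Disjoint (F \\ F) ((F \\ F).image (fun z => U \ z)) := by
    rw [disjoint_left]
    intro e he he'
    obtain ⟨e', he'', hee⟩ := mem_image.mp he'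
    rw [Finset.mem_diffs] at he he''
    obtain ⟨f, hf, g, hg, rfl⟩ := he
    obtain ⟨f', hf', g', hg', rfl⟩ := he''
    obtain ⟨i, hi⟩ := hint g hg g' hg'
    rw [mem_inter] at hi
    -- i ∈ g' so i ∉ f' \ g', so i ∈ U \ (f' \ g') = f \ g, so i ∉ g: contradiction
    have h1 : i ∈ U \ (f' \ g') := by
      rw [mem_sdiff, mem_sdiff, not_and, not_not]
      exact ⟨hFU g hg hi.1, fun _ => hi.2⟩
    rw [hee, mem_sdiff] at h1
    exact h1.2 hi.1
  have hinj : Set.InjOn (fun z : Finset α => U \ z) ↑(F \\ F) := by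
    intro p hp q hq hpq
    have hpU : p ⊆ U := by
      obtain ⟨f, hf, g, _, rfl⟩ := Finset.mem_diffs.mp (mem_coe.mp hp); exact sdiff_subset.trans (hFU f hf)
    have hqU : q ⊆ U := by
      obtain ⟨f, hf, g, _, rfl⟩ := Finset.mem_diffs.mp (mem_coe.mp hq); exact sdiff_subset.trans (hFU f hf)
    have e := congrArg (fun t => U \ t) hpq
    simp only [Finset.sdiff_sdiff_eq_self hpU, Finset.sdiff_sdiff_eq_self hqU] at e
    exact e
  rw [card_union_of_disjoint hdisj, card_image_of_injOn hinj] at htight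
  omega

/-- **The Δ-MS-tight case of two-class (MATCH), from the MS equality structure.**  Assume `MSEqualityStructure α`.  If `F` is a family of dead
members with labels in `{ℓ, ℓ+1}` and `#(cl(F \\ F)) = 2 #F`, then `A = F ∪ co F` satisfies Hall's condition `#A ≤ #(⋃_{a ∈ A} candidates a)`. -/
theorem card_le_card_biUnion_candidates_of_tight (hMS : MSEqualityStructure α)
    (hU : ∀ b ∈ 𝒟, b ⊆ U) (hco : ∀ b ∈ 𝒟, U \ b ∈ 𝒟) (hanti : ∀ b ∈ 𝒟, x (U \ b) = x b + 3)
    {F : Finset (Finset α)} (hF : F ⊆ dead U 𝒟 x) {ℓ : ZMod 6} (hlab : ∀ f ∈ F, x f = ℓ ∨ x f = ℓ + 1)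
    (htight : #((F \\ F) ∪ (F \\ F).image (fun z => U \ z)) = 2 * #F) :
    #(F ∪ F.image fun f => U \ f) ≤ #((F ∪ F.image fun f => U \ f).biUnion (candidates 𝒟 x)) := by
  have hFD : ∀ f ∈ F, f ∈ 𝒟 := fun f hf => (mem_filter.mp (hF hf)).1
  have hFU : ∀ f ∈ F, f ⊆ U := fun f hf => hU f (hFD f hf)
  -- F is intersecting: two dead members with close labels meet
  have hint : ∀ f ∈ F, ∀ g ∈ F, (f ∩ g).Nonempty := fun f hf g hg =>
    inter_nonempty_of_dead_of_close (hF hf) (hFD g hg) (close_of_mem_pair (hlab f hf) (hlab g hg))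
  have hms : #(F \\ F) = #F := card_diffs_eq_card_of_cl_tight hFU hint htight
  obtain ⟨a, I, D₁, D₂, hd₁I, hd₂, hcl₁, hcl₂, hFdef⟩ := hMS F hms
  exact card_le_card_biUnion_candidates_of_twistedProduct hU hco hanti hd₁I hd₂ hcl₁ hcl₂ hFdef hF hlab

end GeneratedDonors

end Summit.CriticalPhenomena.PercolationContinuityZ3.Theorems
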